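import Mathlib.Analysis.Asymptotics.Lemmas
import Mathlib.Analysis.SpecialFunctions.Pow.Asymptotics
import Mathlib.Analysis.SpecialFunctions.Pow.Real
import Literature.Computability.AlgebraicComplexity.CohnUmansTPPProofs
import Summits.MatrixMultiplication.MatrixMultiplication.Theses.EPRFaces
import HarnessLib

/-!
# Route EPRFaces — support item `RungTwoConsequences` (stmt-MatrixMultiplication-10898)

The `k = 2` rung of the EPR ladder, `R(⟨n,n,n²⟩) = O(n^{3+ε})` for every `ε > 0`, implies

* `ω(ℂ) ≤ 9/4`: by the single-summand asymptotic sum inequality in rank form,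
  `(n·n·n²)^{ω/3} = n^{4ω/3} ≤ R(⟨n,n,n²⟩)` (Bürgisser–Clausen–Shokrollahi 1997, Prop. 15.5;
  Bläser 2013, Thm. 5.9 — the tree's `rpow_omega_div_three_le_tensorRank`), so
  `n^{4ω/3} ≤ C·n^{3+ε}` for all large `n`, whence `4ω/3 ≤ 3 + ε` for every `ε > 0`
  (otherwise `n^{4ω/3-3-ε} → ∞`), i.e. `ω ≤ 9/4`;
* the perfect-amortisation statement `E` of the route (`∀ ε > 0 ∃ k ≥ 1, R(⟨n,n,n^k⟩) =
  O(n^{k+1+ε})`): take `k = 2`, since `(2 : ℕ) + 1 + ε = 3 + ε`.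

No new definitions, no named facts: the theorem is unconditional.

References: [Blaser2013, Thm. 5.9], [BurgisserClausenShokrollahi1997, Prop. 15.5],
[AlmanDuanVassilevskaWilliamsXuXuZhou2025, Thm. 3.1].
-/

-- the tree's namespace `Summit.MatrixMultiplication.MatrixMultiplication.…` repeats a component by design
set_option linter.dupNamespace false

namespace Summit.MatrixMultiplication.MatrixMultiplication.Theorems

open Filter Asymptotics
open Literature.Computability.AlgebraicComplexity

/-- **Rank form of the exponent bound from a rectangular rung.** If `R(⟨n,n,n²⟩) = O(n^{3+ε})`
for every `ε > 0`, then `4·ω(ℂ)/3 ≤ 3 + ε` for every `ε > 0`: the single-summand asymptotic sum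
inequality `(n·n·n²)^{ω/3} ≤ R(⟨n,n,n²⟩)` (BCS Prop. 15.5 / Bläser Thm. 5.9) against the
`O`-bound, and `n^{4ω/3-(3+ε)} → ∞` if the exponent were positive. -/
theorem four_mul_omega_div_three_le_of_rung_two
    (h : ∀ ε : ℝ, 0 < ε → (fun n : ℕ => (tensorRank (matMulTensor ℂ n n (n ^ 2)) : ℝ))
      =O[atTop] fun n : ℕ => (n : ℝ) ^ ((3 : ℝ) + ε))
    {ε : ℝ} (hε : 0 < ε) : 4 * omega ℂ / 3 ≤ 3 + ε := by
  by_contra hlt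
  rw [not_le] at hlt
  obtain ⟨C, hC⟩ := isBigO_iff.1 (h ε hε)
  -- eventually `n ^ (4ω/3 - (3 + ε)) ≤ C`
  have hev : ∀ᶠ n : ℕ in atTop, (n : ℝ) ^ (4 * omega ℂ / 3 - (3 + ε)) ≤ C := by
    filter_upwards [hC, eventually_gt_atTop 0] with n hn hn0
    have hn0' : (0 : ℝ) < n := Nat.cast_pos.2 hn0
    rw [Real.norm_of_nonneg (Nat.cast_nonneg _),
      Real.norm_of_nonneg (Real.rpow_nonneg (Nat.cast_nonneg _) _)] at hn
    -- the asymptotic sum inequality with one summand: `(n·n·n²)^{ω/3} ≤ R(⟨n,n,n²⟩)`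
    have h1 : 1 ≤ n * n * n ^ 2 := by
      have : 1 ≤ n := hn0
      calc 1 = 1 * 1 * 1 ^ 2 := by norm_num
        _ ≤ n * n * n ^ 2 := by gcongr
    have hasi := rpow_omega_div_three_le_tensorRank ℂ h1
    have hpow : (n : ℝ) ^ (4 * omega ℂ / 3) ≤ C * (n : ℝ) ^ ((3 : ℝ) + ε) := by
      refine le_trans ?_ (hasi.trans hn)
      have hrw : ((n * n * n ^ 2 : ℕ) : ℝ) = (n : ℝ) ^ (4 : ℕ) := by push_cast; ring
      rw [hrw, ← Real.rpow_natCast, ← Real.rpow_mul hn0'.le]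
      refine le_of_eq ?_
      congr 1
      push_cast
      ring
    rw [Real.rpow_sub hn0', div_le_iff₀ (Real.rpow_pos_of_pos hn0' _)]
    exact hpow
  -- but `n ^ (4ω/3 - (3 + ε)) → ∞`
  have hlim : Tendsto (fun n : ℕ => (n : ℝ) ^ (4 * omega ℂ / 3 - (3 + ε))) atTop atTop :=
    (tendsto_rpow_atTop (by linarith)).comp tendsto_natCast_atTop_atTop
  obtain ⟨n, hn₁, hn₂⟩ := (hev.and (hlim.eventually_gt_atTop C)).exists
  exact absurd hn₁ (not_le.2 hn₂)

/-- **Item `RungTwoConsequences` (stmt-MatrixMultiplication-10898) of route EPRFaces, proved.**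
From the rung `R(⟨n,n,n²⟩) = O(n^{3+ε})` (`∀ ε > 0`): `ω(ℂ) ≤ 9/4` (by
`four_mul_omega_div_three_le_of_rung_two`, letting `ε → 0`) and the route's perfect-amortisation
statement `E` with the witness `k = 2` (`(2 : ℕ) + 1 + ε = 3 + ε`). -/
theorem rungTwoConsequences_proof :
    Summit.MatrixMultiplication.MatrixMultiplication.Theses.EPRFaces.RungTwoConsequences := by
  unfold Summit.MatrixMultiplication.MatrixMultiplication.Theses.EPRFaces.RungTwoConsequences
  intro h
  refine ⟨?_, fun ε hε => ⟨2, by norm_num, ?_⟩⟩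
  · -- `ω ≤ 9/4`: `4ω/3 ≤ 3 + δ` for every `δ > 0`
    refine le_of_forall_pos_lt_add fun δ hδ => ?_
    have hk := four_mul_omega_div_three_le_of_rung_two h hδ
    linarith
  · -- `E` at `k = 2`
    have h3 : ((2 : ℕ) : ℝ) + 1 + ε = (3 : ℝ) + ε := by norm_num
    rw [h3]
    exact h ε hε

end Summit.MatrixMultiplication.MatrixMultiplication.Theorems
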